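import Mathlib.Analysis.Complex.Circle
import Mathlib.Analysis.Complex.Polynomial.Basic
import Mathlib.GroupTheory.Torsion
import Mathlib.Topology.Separation.Lemmas
import Literature.AlgebraicGeometry.Frobenioids.NumberFieldLocalizationCategoriesArrowwiseClosureRefuted
import Literature.AlgebraicGeometry.Frobenioids.NumberFieldLocalizationCategoriesFSMFF
import HarnessLib

/-!
# Frobenioids II, Ex. 1.4 (ii) — `E₀ → P₀` arrow-wise essentially surjective: the two topological binders
# of the instance form are INDEPENDENTLY necessary (`μ_∞ ⊂ S¹`) — PROOF-ONLY

Mochizuki, *The geometry of Frobenioids II: poly-Frobenioids*, Kyushu J. Math. **62** (2008) 401–460,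
Example 1.4 (ii), kurims p. 13 [cite: MochizukiFrdII2008, Ex. 1.4 (ii) p.13] ("`E₀ → P₀` is … arrow-wise
essentially surjective", there for `G = Gal(F̃/F)` PROFINITE and `D ⊆ G` a decomposition group).

abc-iut cell, FACT-LIST wave F (seat f-044, tranche 44), row **F-1172** `NFLocCat.ToP₀ArrowwiseEssSurj G D`.
State of the row in the tree: universal closure REFUTED (`NFLocCat.not_forall_toP₀ArrowwiseEssSurj`,
witness `(ℂˣ, μ₂)`); instance form PROVED for `[IsTopologicalGroup G] [CompactSpace G]
[TotallyDisconnectedSpace G]` (`NFLocCat.toP₀ArrowwiseEssSurj_holds`, profinite `G`, as in print);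
tightness v2: `CompactSpace G` alone does not suffice (`NFLocCat.not_toP₀ArrowwiseEssSurj_circle`, the
compact connected group `S¹ ⊇ {±1}`).  The v2 docstring left the dual question open ("that `CompactSpace G`
is not idle either is witnessed by any divisible discrete group with torsion, e.g. `ℚ/ℤ ⊇ ½ℤ/ℤ`; not
formalised here").  This file closes it with a natural TOPOLOGICAL group that is not discrete by fiat:

* `G = μ_∞`, the torsion subgroup of `S¹` (all roots of unity in `ℂ`) with the subspace topology — a
  topological group that is TOTALLY DISCONNECTED (countable subset of a metric space) and divisible (an
  `n`-th root in `ℂ` of a root of unity is a root of unity of norm `1`), `D = {±1}`: `E₀ → P₀` is NOT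
  arrow-wise essentially surjective (`not_toP₀ArrowwiseEssSurj_torsionCircle`), by the v2 general lemma
  `not_toP₀ArrowwiseEssSurj_of_forall_finiteIndex_eq_top`;
* hence, by the instance form itself, `μ_∞` is NOT compact (`not_compactSpace_torsionCircle`) — so this
  witness sits exactly on the other side of the profinite hypothesis from `S¹`;
* packaged: `compactSpace_and_totallyDisconnectedSpace_independent` — each of the two topological binders of
  `toP₀ArrowwiseEssSurj_holds` is violated by a topological group satisfying the other at which the
  conclusion fails.

Elementary; not in the paper (print only treats profinite `G`).  A statement about OUR typed schema, not
about print; nothing here bears on [IUTchIII] Cor. 3.12.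
-/

namespace Literature.AlgebraicGeometry.Frobenioids

namespace NFLocCat

open Complex

/-- `μ_∞ ⊂ S¹`, the torsion subgroup of the circle group, is DIVISIBLE: every subgroup of finite index is
everything (an `n`-th root in `ℂ` of a root of unity has norm `1` and finite order).
[cite: MochizukiFrdII2008, Ex. 1.4 (ii) p.13] -/
theorem subgroup_torsionCircle_eq_top_of_finiteIndex (U : Subgroup (CommGroup.torsion Circle))
    [U.FiniteIndex] : U = ⊤ := by
  rw [eq_top_iff]
  rintro ⟨u, hu⟩ -
  have hn : 0 < U.index := Nat.pos_of_ne_zero Subgroup.FiniteIndex.index_ne_zero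
  obtain ⟨z, hz⟩ := IsAlgClosed.exists_pow_nat_eq (u : ℂ) hn
  have hz1 : ‖z‖ = 1 := by
    have h1 : ‖z‖ ^ U.index = 1 := by rw [← norm_pow, hz, Circle.norm_coe]
    exact (pow_eq_one_iff_of_nonneg (norm_nonneg z) hn.ne').mp h1
  let v : Circle := ⟨z, mem_sphere_zero_iff_norm.2 hz1⟩
  have hv : v ^ U.index = u := Circle.ext (by rw [Circle.coe_pow]; exact hz)
  obtain ⟨k, hk, huk⟩ := isOfFinOrder_iff_pow_eq_one.mp ((CommGroup.mem_torsion u).mp hu)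
  have hvfin : IsOfFinOrder v :=
    isOfFinOrder_iff_pow_eq_one.mpr ⟨U.index * k, Nat.mul_pos hn hk, by rw [pow_mul, hv, huk]⟩
  have hmem : (⟨v, (CommGroup.mem_torsion v).mpr hvfin⟩ : CommGroup.torsion Circle) ^ U.index =
      ⟨u, hu⟩ := Subtype.ext (by rw [Subgroup.coe_pow]; exact hv)
  rw [← hmem]
  exact U.pow_index_mem _

/-- `μ_∞` is COUNTABLE: it is the union over `n ≥ 1` of the finite sets of `n`-th roots of unity.
[cite: MochizukiFrdII2008, Ex. 1.4 (ii) p.13] -/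
theorem countable_torsionCircle : (CommGroup.torsion Circle : Set Circle).Countable := by
  have hsub : (CommGroup.torsion Circle : Set Circle) ⊆ ⋃ n : ℕ, {z : Circle | z ^ (n + 1) = 1} := by
    intro z hz
    obtain ⟨n, hn, hzn⟩ := isOfFinOrder_iff_pow_eq_one.mp ((CommGroup.mem_torsion z).mp hz)
    refine Set.mem_iUnion.mpr ⟨n - 1, ?_⟩
    show z ^ (n - 1 + 1) = 1
    rwa [Nat.sub_add_cancel hn]
  refine Set.Countable.mono hsub (Set.countable_iUnion fun n => Set.Finite.countable ?_)
  have hC : {w : ℂ | w ^ (n + 1) = 1}.Finite :=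
    (Multiset.finite_toSet (Polynomial.nthRoots (n + 1) (1 : ℂ))).subset fun w hw =>
      (Polynomial.mem_nthRoots n.succ_pos).mpr hw
  have hpre : ((fun z : Circle => (z : ℂ)) ⁻¹' {w : ℂ | w ^ (n + 1) = 1}).Finite :=
    hC.preimage fun a _ b _ hab => Circle.ext hab
  refine hpre.subset ?_
  intro z hz
  have hz' : z ^ (n + 1) = 1 := hz
  show ((z : Circle) : ℂ) ^ (n + 1) = 1
  rw [← Circle.coe_pow, hz', Circle.coe_one]

/-- `μ_∞` with the subspace topology of `S¹` is TOTALLY DISCONNECTED (a countable subset of a metric space).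
[cite: MochizukiFrdII2008, Ex. 1.4 (ii) p.13] -/
theorem totallyDisconnectedSpace_torsionCircle : TotallyDisconnectedSpace (CommGroup.torsion Circle) :=
  totallyDisconnectedSpace_subtype_iff.2 countable_torsionCircle.isTotallyDisconnected

/-- `-1 ∈ μ_∞`. [cite: MochizukiFrdII2008, Ex. 1.4 (ii) p.13] -/
theorem neg_one_mem_torsionCircle : (-1 : Circle) ∈ CommGroup.torsion Circle :=
  (CommGroup.mem_torsion _).mpr (isOfFinOrder_iff_pow_eq_one.mpr ⟨2, two_pos, neg_one_sq⟩)

/-- **Tightness of the instance form at a TOTALLY DISCONNECTED topological group**: for `G = μ_∞ ⊂ S¹`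
(torsion subgroup of the circle, subspace topology: totally disconnected, divisible) and `D = {±1}`,
`E₀ → P₀` is NOT arrow-wise essentially surjective — so the hypothesis `CompactSpace G` of
`NFLocCat.toP₀ArrowwiseEssSurj_holds` (profinite `G = Gal(F̃/F)` in print) is not idle.
[cite: MochizukiFrdII2008, Ex. 1.4 (ii) p.13] -/
theorem not_toP₀ArrowwiseEssSurj_torsionCircle :
    ¬ Literature.AlgebraicGeometry.Frobenioids.NFLocCat.ToP₀ArrowwiseEssSurj (CommGroup.torsion Circle)
        (Subgroup.zpowers (⟨-1, neg_one_mem_torsionCircle⟩ : CommGroup.torsion Circle)) := by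
  set m : CommGroup.torsion Circle := ⟨-1, neg_one_mem_torsionCircle⟩ with hm
  have hfin : IsOfFinOrder m :=
    isOfFinOrder_iff_pow_eq_one.mpr ⟨2, two_pos, Subtype.ext (by rw [Subgroup.coe_pow, hm]; exact neg_one_sq)⟩
  haveI : Finite (Subgroup.zpowers m) := hfin.finite_zpowers.to_subtype
  refine not_toP₀ArrowwiseEssSurj_of_forall_finiteIndex_eq_top
    (fun U hU => subgroup_torsionCircle_eq_top_of_finiteIndex U) (Subgroup.zpowers m)
    ⟨m, Subgroup.mem_zpowers _⟩ fun e => Circle.neg_ne_self 1 ?_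
  have e' : m = 1 := congrArg Subtype.val e
  exact congrArg Subtype.val e'

/-- **Corollary: `μ_∞ ⊂ S¹` is not compact** — read off the instance form itself: `μ_∞` is a totally
disconnected topological group at which the conclusion of `toP₀ArrowwiseEssSurj_holds` fails, so it cannot
also be compact. [cite: MochizukiFrdII2008, Ex. 1.4 (ii) p.13] -/
theorem not_compactSpace_torsionCircle : ¬ CompactSpace (CommGroup.torsion Circle) := by
  intro hc
  haveI := totallyDisconnectedSpace_torsionCircle
  exact not_toP₀ArrowwiseEssSurj_torsionCircle (toP₀ArrowwiseEssSurj_holds _)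

/-- **The two topological binders of the instance form `NFLocCat.toP₀ArrowwiseEssSurj_holds` are
INDEPENDENTLY necessary**: there is a COMPACT topological group (`S¹`, with `D = {±1}`) and there is a
TOTALLY DISCONNECTED topological group (`μ_∞ ⊂ S¹`, with `D = {±1}`) at which `E₀ → P₀` fails to be
arrow-wise essentially surjective; print's `G = Gal(F̃/F)` is both (profinite).
[cite: MochizukiFrdII2008, Ex. 1.4 (ii) p.13] -/
theorem compactSpace_and_totallyDisconnectedSpace_independent :
    (∃ (G : Type) (_ : Group G) (_ : TopologicalSpace G) (_ : IsTopologicalGroup G) (_ : CompactSpace G)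
        (D : Subgroup G), ¬ Literature.AlgebraicGeometry.Frobenioids.NFLocCat.ToP₀ArrowwiseEssSurj G D) ∧
    (∃ (G : Type) (_ : Group G) (_ : TopologicalSpace G) (_ : IsTopologicalGroup G)
        (_ : TotallyDisconnectedSpace G) (D : Subgroup G),
          ¬ Literature.AlgebraicGeometry.Frobenioids.NFLocCat.ToP₀ArrowwiseEssSurj G D) :=
  ⟨⟨Circle, inferInstance, inferInstance, inferInstance, inferInstance, _, not_toP₀ArrowwiseEssSurj_circle⟩,
    ⟨CommGroup.torsion Circle, inferInstance, inferInstance, inferInstance,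
      totallyDisconnectedSpace_torsionCircle, _, not_toP₀ArrowwiseEssSurj_torsionCircle⟩⟩

end NFLocCat

end Literature.AlgebraicGeometry.Frobenioids
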